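import Summits.Ventures.Crystal3D.Theorems.StickyWulffConstantNoReconstructionGainExactPartnerReplication
import Summits.Ventures.Crystal3D.Theorems.StickyWulffConstantNoReconstructionGainSupportedFilm
import HarnessLib

/-!
# No criminal is supported from below along six lines at every ball (line `replication-exactness`)

HONEST FRAMING. Part of the venture `Summits/Ventures/Crystal3D` (cell `crystal3d-full`), supports the
crux `NoReconstructionGain` (stmt-Ventures-19144, route `route-Ventures-StickyWulffConstant`), line
`replication-exactness` (lead wulff-p1 g18).  Second instantiation of the PARTNER licence
`not_isCriminal_of_partnerAtom` (`…ExactPartnerReplication`), with the first alternative of the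
landed rung `supportedFilm_adhesion` (`…SupportedFilm`: if every film ball's partners OTHER than film
balls strictly above it lie on at most six lines through its centre, the film gains at most `C ρ`,
every normal).

* `not_isCriminal_of_supportedBelow` — a film on `H(ν,s)` such that every ball `q` admits at most
  six vectors `W` with every plug of `q` and every film partner of `q` not strictly `ν`-above `q` of
  the form `q ± w`, `w ∈ W`, is not a criminal.  (Every ball of an fcc- or hcp-like environment, in
  any orientation varying from ball to ball, has this pattern; partners strictly above are free.)

WHAT THIS IS NOT: the registry alternatives of `supportedFilm_adhesion` (basal cones) are not
instantiated here; the crux is not moved; rung F-C1 not moved.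
-/

noncomputable section

namespace Summit.Ventures.Crystal3D.Theorems

open Summit.Ventures.Crystal3D
open Literature.MathematicalPhysics.StatisticalMechanics (fccStacking contactDeficiency)
open scoped InnerProductSpace
open Finset

/-- **No criminal is supported from below along six lines at every ball.** -/
theorem not_isCriminal_of_supportedBelow {ν : EuclideanSpace ℝ (Fin 3)} (hν : ‖ν‖ = 1) {s : ℝ}
    {Q : Finset (EuclideanSpace ℝ (Fin 3))}
    (hQ : ∀ q ∈ Q, ∃ W : Finset (EuclideanSpace ℝ (Fin 3)), W.card ≤ 6 ∧
      (∀ x ∈ plugSet ν s q, ∃ w ∈ W, x = q + w ∨ x = q - w) ∧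
      (∀ x ∈ Q, dist q x = 1 → ⟪q, ν⟫_ℝ < ⟪x, ν⟫_ℝ ∨ ∃ w ∈ W, x = q + w ∨ x = q - w)) :
    ¬ IsCriminal ν s Q := by
  classical
  obtain ⟨R, C, hR, h⟩ := supportedFilm_adhesion
  refine not_isCriminal_of_partnerAtom
    (Pf := fun q A B => ∃ W : Finset (EuclideanSpace ℝ (Fin 3)), W.card ≤ 6 ∧
      (∀ x ∈ A, ∃ w ∈ W, x = q + w ∨ x = q - w) ∧
      (∀ x ∈ B, ⟪q, ν⟫_ℝ < ⟪x, ν⟫_ℝ ∨ ∃ w ∈ W, x = q + w ∨ x = q - w)) (C := C) ?_ hν hR ?_ ?_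
  · -- covariance
    rintro q A B ⟨W, hW, hA, hB⟩ t -
    have hline : ∀ a, (∃ w ∈ W, a = q + w ∨ a = q - w) →
        ∃ w ∈ W, a + t = q + t + w ∨ a + t = q + t - w := by
      rintro a ⟨w, hw, hor⟩
      refine ⟨w, hw, ?_⟩
      rcases hor with rfl | rfl
      · left; abel
      · right; abel
    refine ⟨W, hW, fun x hx => ?_, fun x hx => ?_⟩
    · obtain ⟨a, ha, rfl⟩ := Finset.mem_image.1 hx
      exact hline a (hA a ha)
    · obtain ⟨b, hb, rfl⟩ := Finset.mem_image.1 hx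
      rcases hB b hb with hup | hl
      · left; rw [inner_add_left, inner_add_left]; linarith only [hup]
      · right; exact hline b hl
  · -- the atom: first alternative of `supportedFilm_adhesion`
    intro ρ hρ X P hpack hPX hP habove hPf
    refine h ν hν ρ hρ X P hpack hPX hP habove fun q hq => Or.inl ?_
    obtain ⟨W, hW, hA, hB⟩ := hPf q hq
    refine ⟨W, hW, fun x hx hd => ?_⟩
    by_cases hxP : x ∈ P
    · exact Or.inr (hA x (Finset.mem_filter.2 ⟨hxP, hd⟩))
    · rcases hB x (Finset.mem_filter.2 ⟨Finset.mem_sdiff.2 ⟨hx, hxP⟩, hd⟩) with hup | hl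
      · exact Or.inl ⟨hxP, hup⟩
      · exact Or.inr hl
  · -- the film's pattern
    intro q hq
    obtain ⟨W, hW, hA, hB⟩ := hQ q hq
    refine ⟨W, hW, fun x hx => hA x ((Set.Finite.mem_toFinset _).1 hx), fun x hx => ?_⟩
    rw [Finset.mem_filter] at hx
    exact hB x hx.1 hx.2

end Summit.Ventures.Crystal3D.Theorems

end
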